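import Summits.QuantumFields.YangMills.Theorems.BalabanUVNodesN08LargeFieldConstFamily

/-!
# BalabanUVNodes ∕ N08 — the COUNTERTERM-SIDE twin of `BalabanUVNodesN08LargeFieldConstFamily`: per-run leaf systems whose (65)-input «|log Z^{(k)}(T₁^{(k)}, 1)|
# ≤ O(1)|T₁^{(k)}|» has a PER-RUN constant do NOT give [Balaban1985UV3] Theorem 1's bounds (5), even in the compact reading and with `d(𝔤) = 0`
# (Track A, DAG node N08; cell `pub-ymgap`, R141 (C) fan-out seat `pub-ymgap-dag-n08-e`, FAN-OUT v1.1 §N08 row s3 «(5) NOT automatic … G-B10 rows»; `--supports` K1)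

CITATION HEADER.  Source: T. Bałaban, *Ultraviolet stability of three-dimensional lattice pure gauge field theories*, CMP **102**, 255–275 (1985), bib
`Balaban1985UV3` (journal page = PDF page + 254): (62) p. 271 «E^{(k)} = log σ₀|T₁^{(k)*}| + d(𝔤) log g_k|T₁^{(k)*}| + log Z^{(k)}(T₁^{(k)}, 1) + Σ_X 𝒫′_{k+1}(g_k, X, 1)»;
(64)–(65) p. 273 «E_k = Σ_{j=k}^{K−1} E^{(j)} … we get easily |E^{(j)}| ≤ O(1)|T₁^{(j)}|»; (5) p. 256; p. 257 L1 «the constant O(1) is independent of ε, k, g_k in a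
bounded set».  The cell carries the O(1) of the `log Z^{(k)}(T₁^{(k)}, 1)` term as `B10Assembly.Consts.z` (leaf `LeafSystem.logZT_le`; GAPS G-B10-01 ∕ (L5)).

WHAT THIS MODULE DOES (value = a consistency statement about the TYPING, nothing about Yang–Mills; Summits-side like its companion).  The companion breaks
(5) through the large-field constant `d` of pp. 273–274 (upper half of (5) only).  THIS module breaks it through the COUNTERTERM: the model `ctRun z K` is the
cell's logarithmic witness `B10DagLeaf.logRun` with `d(𝔤) = 0` and `log Z^{(k)}(·, ·) ≡ −z|T₁^{(k)}|` at every step (so (62) gives `E^{(k)} = −z|T₁^{(k)}|`,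
(64) `E_k = −z Σ_{j=k}^{K−1}|T₁^{(j)}|`, and `ρ_k ≡ e^{−E_k}` makes (41), (47), (55), (55)′ EQUALITIES); it carries a leaf system for `trivConsts` with `z := z`
(`ctLeafSystem`: the (L5) input `|log Z^{(k)}(T₁^{(k)}, 1)| ≤ z|T₁^{(k)}|` with equality).  For the family `n ↦ ctRun n K`, `K ≥ 1` (per-run constants `ctConsts n`):
every run carries a leaf system, couplings in (0, 1], `B10.Thm2Printed` holds run by run, and **`B10.Thm1PrintedCompact` FAILS** at the BARE scale k = 0
(`ρ₀ = e^{−E₀} ≥ e^{n|T₁^{(0)}|}` against `e^{O(1)|T₁^{(0)}|}`) — `not_thm1Compact_ctFamily`, packaged `perRunCounterterm_separation`.  So the ε-uniformity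
of the (65) constants (print's «we get easily») is load-bearing for (5) independently of the `d(𝔤) log g_k` window term (which `B10DagLeaf` isolates) and of the
large fields (companion).

§3 adds the CONVERSE separation over the carrier: a functional-free model (`LF ≡ 0`, `ρ ≡ 1`, slot `False`) on which (5) holds with O(1) = 0 while (41) — hence
Thm 2 and every leaf system — fails (`thm1Compact_not_thm2_separation`): the two conjuncts of N08's slot are independent, the split is proper on both sides.

WHAT IS NOT CLAIMED.  Nothing about Bałaban's `Z^{(k)}` or whether its logarithm is ε-uniformly O(1) per site (the audit question at this leaf); the model is a
bookkeeping device over `B10.TowerRun`.  HONEST FRAMING: d = 3 finite tori of [B10]; nothing continuum ∕ ℝ⁴ ∕ OS ∕ mass gap ∕ Clay.  No `sorry`, no `axiom`,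
no `instance`, no `notation`.
-/

noncomputable section

namespace Summit.QuantumFields.YangMills.Theorems.BalabanUVNodesN08CountertermConstFamily

open Literature.MathematicalPhysics.QuantumFieldTheory.Balaban1983to89
open Literature.MathematicalPhysics.QuantumFieldTheory.Balaban1983to89.B10
open Literature.MathematicalPhysics.QuantumFieldTheory.Balaban1983to89.B10Assembly
open Literature.MathematicalPhysics.QuantumFieldTheory.Balaban1983to89.B10SectAGathering
open Summit.QuantumFields.YangMills.Theorems.BalabanUVNodesN08LargeFieldConstFamily (lfEps lfEps_pos scale_le_one_lf)

/-! ## §1. The counterterm model `ctRun z K` and its leaf system -/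

section Model

/-- Family constants of the counterterm model: the cell's `B10Assembly.trivConsts` except the (65)-constant `z ≥ 0` of the `log Z^{(k)}(T₁^{(k)}, 1)` term.
A bookkeeping device. [folklore] -/
def ctConsts (z : ℝ) (hz : 0 ≤ z) : Consts :=
  { trivConsts with z := z, z_nonneg := hz }

/-- E^{(k)} of the model by (62) with `log σ₀ = d(𝔤) = Σ𝒫′ = 0` and `log Z^{(k)}(T₁^{(k)}, 1) = −z|T₁^{(k)}|`: `E^{(k)} = −z|T₁^{(k)}|`. [folklore] -/
def ctEstep (z : ℝ) (K k : ℕ) : ℝ := -(z * sitesRun 2 (lfEps K) 1 k)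

/-- E_k of the model by (64): `E_k = Σ_{j=k}^{K−1} E^{(j)}`. [folklore] -/
def ctEcst (z : ℝ) (K k : ℕ) : ℝ := ∑ j ∈ Finset.Ico k K, ctEstep z K j

/-- (64) one step down: `E_k = E^{(k)} + E_{k+1}` for `k < K`. [folklore] -/
theorem ctEcst_succ (z : ℝ) {K k : ℕ} (hk : k + 1 ≤ K) : ctEcst z K k = ctEstep z K k + ctEcst z K (k + 1) := by
  unfold ctEcst
  rw [Finset.sum_eq_sum_Ico_succ_bot (by omega : k < K)]

/-- **The counterterm model run of depth K**: `B10DagLeaf.logRun`'s architecture (one configuration ∕ history per scale, χ ≡ 1, `LF_k(U, F) = e^{F(·)}`,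
g_k = (2^kε)^{1/2}, |T₁^{(k)}| = (2^kε)^{−3}, ε = 2^{−K}, everything else 0) with the counterterms `ctEstep`, `ctEcst` and **ρ_k ≡ exp(−E_k)**. [folklore] -/
def ctRun (z : ℝ) (K : ℕ) : TowerRun where
  K := K
  Cfg := fun _ => Unit
  ρ := fun k _ => Real.exp (-ctEcst z K k)
  χ := fun _ _ => 1
  wilsonBG := fun _ _ => 0
  sites := sitesRun 2 (lfEps K) 1
  g := gRun 1 2 (lfEps K)
  Ineq41_47 := fun _ => True
  Hist := fun _ => Unit
  triv := fun _ => ()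
  LF := fun _ _ F => Real.exp (F ())
  lf_mono := fun _ _ F G hFG => Real.exp_le_exp.mpr (hFG ())
  lf_shift := fun _ _ F t => by
    show Real.exp (F () + t) = Real.exp t * Real.exp (F ())
    rw [Real.exp_add, mul_comm]
  mainT := fun _ _ _ => 0
  mainT_triv := fun _ _ => by simp
  Pint := fun _ _ _ => 0
  Λvol := fun _ _ => 0
  Λvol_le := fun k _ => sitesRun_nonneg 2 _ 1 (by norm_num) (lfEps_pos K) zero_le_one k
  Zterm := fun _ _ => 0
  Zterm_triv := fun _ => rfl
  Ecst := ctEcst z K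
  Estep := ctEstep z K
  Ecst_eq := fun _ => rfl
  Rm := fun _ => 0
  χ_nonneg := fun _ _ => zero_le_one
  sites_nonneg := fun k => sitesRun_nonneg 2 _ 1 (by norm_num) (lfEps_pos K) zero_le_one k
  M₁ := 0
  b₀ := 0
  p₀ := 1

variable (z : ℝ) (K : ℕ)

/-- **(41)_k holds in the model, with equality**: `ρ_k = e^{−E_k} = LF_k(U, −A + 𝒫 − E_k + Z + R)`. [folklore] -/
theorem ineq41_ctRun (k : ℕ) : Ineq41 (ctRun z K) k := by
  intro U
  show Real.exp (-ctEcst z K k) ≤ Real.exp (-(0 : ℝ) + 0 - ctEcst z K k + 0 + 0)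
  simp

/-- **(47)_k holds in the model, with equality**: `χ_k·e^{−A + 𝒫 − E_k − R} = e^{−E_k} = ρ_k`. [folklore] -/
theorem ineq47_ctRun (k : ℕ) : Ineq47 (ctRun z K) k := by
  intro U
  show (1 : ℝ) * Real.exp (-(0 : ℝ) + 0 - ctEcst z K k - 0) ≤ Real.exp (-ctEcst z K k)
  simp

/-- The step pieces of the model: `log Z^{(k)}(B, U) = log Z^{(k)}(B, 1) = log Z^{(k)}(T₁^{(k)}, 1) = −z|T₁^{(k)}|`, everything else 0. [folklore] -/
def ctPieces (k : ℕ) : StepPieces (ctRun z K) k where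
  proj := fun _ => ()
  proj_triv := rfl
  Zvol := fun _ => 0
  Zvol_nonneg := fun _ => le_rfl
  Zvol_triv := rfl
  starB := fun _ => 0
  starT := 0
  logσ₀ := 0
  dg := 0
  dg_nonneg := le_rfl
  logZU := fun _ _ => -(z * sitesRun 2 (lfEps K) 1 k)
  logZ1 := fun _ => -(z * sitesRun 2 (lfEps K) 1 k)
  logZT := -(z * sitesRun 2 (lfEps K) 1 k)
  logFl := fun _ _ => 0
  PprU := fun _ _ => 0
  Ppr1 := fun _ => 0
  PprT := 0
  PY := fun _ _ => 0
  PYZ := fun _ _ => 0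
  Pold := fun _ _ => 0
  PoldIn := fun _ _ => 0
  rem := ((2 : ℝ) ^ k * lfEps K) ^ ((3 : ℝ) + 1 / 4) * sitesRun 2 (lfEps K) 1 k
  rem_nonneg := mul_nonneg (Real.rpow_nonneg (by have := lfEps_pos K; positivity) _)
    (sitesRun_nonneg 2 _ 1 (by norm_num) (lfEps_pos K) zero_le_one k)

/-- The fourteen step leaves hold in the model at every k < K, all constants 0 ((55)∕(55)′ with EQUALITY by (62) + (64)). [folklore] -/
def ctLeaves (k : ℕ) (hk : k + 1 ≤ K) : StepLeaves (ctRun z K) k where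
  P := ctPieces z K k
  Cz := 0
  C₁ := 0
  C₁' := 0
  C₂ := 0
  Cv := 0
  C₃ := 0
  C₄ := 0
  C₅ := 0
  c₁ := 0
  C₆ := 0
  bound55 := fun _ U => by
    show Real.exp (-ctEcst z K (k + 1)) ≤
      Real.exp (-(0 : ℝ) - ctEcst z K k + ((0 : ℝ) + 0 * Real.log (gRun 1 2 (lfEps K) k)) * 0 + -(z * sitesRun 2 (lfEps K) 1 k) + 0 + 0 + 0 + 0)
    rw [ctEcst_succ z hk]
    unfold ctEstep
    apply Real.exp_le_exp.mpr
    ring_nf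
    exact le_rfl
  bound55Lower := fun _ U => by
    show (1 : ℝ) * Real.exp (-(0 : ℝ) - ctEcst z K k + ((0 : ℝ) + 0 * Real.log (gRun 1 2 (lfEps K) k)) * 0 + -(z * sitesRun 2 (lfEps K) 1 k) + 0 - 0 + 0) ≤
      Real.exp (-ctEcst z K (k + 1))
    rw [one_mul, ctEcst_succ z hk]
    unfold ctEstep
    apply Real.exp_le_exp.mpr
    ring_nf
    exact le_rfl
  cumulant58 := fun h U => by simp [ctRun, ctPieces]
  cumulantLower := fun U => by simp [ctRun, ctPieces]
  repr33_60 := fun h U => by simp [ctPieces]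
  vacuumWhole := fun h => by simp [ctRun, ctPieces]
  decomp35_61 := fun h U => by simp [ctPieces]
  norm35 := fun h => by simp [ctPieces]
  starCount := fun h => by simp [ctPieces]
  oldOutside := fun h U => by simp [ctPieces]
  pintSucc := fun h U => by simp [ctRun, ctPieces]
  estep62 := by
    show ctEstep z K k = ((0 : ℝ) + 0 * Real.log (gRun 1 2 (lfEps K) k)) * 0 + -(z * sitesRun 2 (lfEps K) 1 k) + 0
    unfold ctEstep
    ring
  ztermSucc := fun h => by simp [ctRun, ctPieces]
  rmSucc := by simp [RmSucc, ctRun, ctPieces]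

variable {z} in
/-- **THE MODEL RUN CARRIES A LEAF SYSTEM for `ctConsts z`** (`z ≥ 0`): the (L5) input `|log Z^{(k)}(T₁^{(k)}, 1)| ≤ z|T₁^{(k)}|` with EQUALITY. [folklore] -/
def ctLeafSystem (hz : 0 ≤ z) (K : ℕ) : LeafSystem (ctConsts z hz) (ctRun z K) where
  ε := lfEps K
  Tε := 1
  ε_pos := lfEps_pos K
  Tε_nonneg := zero_le_one
  g_eq := fun _ => rfl
  sites_eq := fun _ => rfl
  scale_le_one := fun k hk => scale_le_one_lf hk
  g_le_one := fun k hk => by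
    show 1 * Real.sqrt ((2 : ℝ) ^ k * lfEps K) ≤ 1
    rw [one_mul]
    calc Real.sqrt ((2 : ℝ) ^ k * lfEps K) ≤ Real.sqrt 1 := Real.sqrt_le_sqrt (scale_le_one_lf hk)
      _ = 1 := Real.sqrt_one
  par := ⟨rfl, rfl, rfl⟩
  spec := fun k => ⟨fun _ => ⟨ineq41_ctRun z K k, ineq47_ctRun z K k⟩, fun _ => trivial⟩
  step0 := ⟨ineq41_ctRun z K 0, ineq47_ctRun z K 0⟩
  noInt0 := fun _ _ => rfl
  steps := fun k hk => ctLeaves z K k hk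
  Λvol_nonneg := fun _ _ => le_rfl
  bound46 := fun k _ _ h U => by simp [ctRun, ctConsts, trivConsts]
  starT_nonneg := fun _ _ => le_rfl
  starT_le := fun k _ => by
    show (0 : ℝ) ≤ 3 * (ctRun z K).sites k
    exact mul_nonneg (by norm_num) ((ctRun z K).sites_nonneg k)
  logσ₀_le := fun _ _ => by simp [ctPieces, ctLeaves, ctConsts, trivConsts]
  dg_le := fun _ _ => by
    show (0 : ℝ) ≤ 0
    exact le_rfl
  logZT_le := fun k _ => by
    have hs : 0 ≤ z * sitesRun 2 (lfEps K) 1 k :=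
      mul_nonneg hz (sitesRun_nonneg 2 _ 1 (by norm_num) (lfEps_pos K) zero_le_one k)
    show |-(z * sitesRun 2 (lfEps K) 1 k)| ≤ z * sitesRun 2 (lfEps K) 1 k
    rw [abs_neg, abs_of_nonneg hs]
  PprT_le := fun _ _ => by simp [ctPieces, ctLeaves, ctConsts, trivConsts]
  rem_eq := fun k _ => by
    show ((2 : ℝ) ^ k * lfEps K) ^ ((3 : ℝ) + 1 / 4) * sitesRun 2 (lfEps K) 1 k = _
    rfl
  Rm_zero := le_rfl
  Rm_succ_le := fun k _ => by simp [ctRun, ctConsts, trivConsts]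
  lf := fun k _ U => by simp [ctRun, ctConsts, trivConsts]

variable {z} in
/-- The couplings of the model lie in (0, 1]. [folklore] -/
theorem ctRun_g_mem (hz : 0 ≤ z) (k : ℕ) (hk : k ≤ K) : 0 < (ctRun z K).g k ∧ (ctRun z K).g k ≤ 1 :=
  ⟨(ctLeafSystem hz K).g_pos k, (ctLeafSystem hz K).g_le_one k hk⟩

/-- `|T₁^{(k)}| > 0` in the model. [folklore] -/
theorem ctRun_sites_pos (k : ℕ) : 0 < (ctRun z K).sites k := by
  show 0 < sitesRun 2 (lfEps K) 1 k
  unfold sitesRun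
  have := lfEps_pos K
  positivity

variable {z K} in
/-- **`−E₀ ≥ z|T₁^{(0)}|` in the model for `K ≥ 1`, `z ≥ 0`**: `−E₀ = z Σ_{j<K}|T₁^{(j)}|` keeps at least its `j = 0` term. [folklore] -/
theorem z_mul_sites_le_neg_ctEcst_zero (hz : 0 ≤ z) (hK : 1 ≤ K) : z * (ctRun z K).sites 0 ≤ -(ctRun z K).Ecst 0 := by
  show z * sitesRun 2 (lfEps K) 1 0 ≤ -∑ j ∈ Finset.Ico 0 K, -(z * sitesRun 2 (lfEps K) 1 j)
  rw [Finset.sum_neg_distrib, neg_neg]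
  have h0 : 0 ∈ Finset.Ico 0 K := Finset.mem_Ico.mpr ⟨le_rfl, by omega⟩
  exact Finset.single_le_sum (f := fun j => z * sitesRun 2 (lfEps K) 1 j)
    (fun j _ => mul_nonneg hz ((ctRun z K).sites_nonneg j)) h0

variable {z K} in
/-- **ANY constant O(1) serving (5) at the BARE scale of the model is ≥ `z`** (`K ≥ 1`, `z ≥ 0`): `ρ₀ = e^{−E₀} ≥ e^{z|T₁^{(0)}|}` against the upper half of (5).
Re-derived bookkeeping. [cite: Balaban1985UV3, (5) p.256 + (62) p.271 + (64) p.273] -/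
theorem le_of_bounds5At_ctRun_zero (hz : 0 ≤ z) (hK : 1 ≤ K) {O1 : ℝ} (h5 : Bounds5At (ctRun z K).toRunData O1 0) : z ≤ O1 := by
  have hup : Real.exp (-(ctRun z K).Ecst 0) ≤ Real.exp (O1 * (ctRun z K).sites 0) := (h5 ()).2
  have h1 := z_mul_sites_le_neg_ctEcst_zero hz hK
  have h2 : z * (ctRun z K).sites 0 ≤ O1 * (ctRun z K).sites 0 := h1.trans (Real.exp_le_exp.mp hup)
  exact le_of_mul_le_mul_right h2 (ctRun_sites_pos z K 0)

end Model

/-! ## §2. The family with per-run (65)-constants: Thm 2 holds, Thm 1 (compact reading) fails at the bare scale -/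

section Family

/-- **The per-run counterterm family**: run `n ∈ ℕ` is the model of depth K with `log Z^{(k)} ≡ −n|T₁^{(k)}|` (per-run leaf constants `ctConsts n`). [folklore] -/
def ctFamily (K : ℕ) (n : ℕ) : TowerRun := ctRun n K

variable (K : ℕ)

/-- Every run of the family carries a leaf system for ITS OWN constants. [folklore] -/
theorem ctFamily_leafSystem (n : ℕ) : Nonempty (LeafSystem (ctConsts n n.cast_nonneg) (ctFamily K n)) :=
  ⟨ctLeafSystem n.cast_nonneg K⟩

/-- The couplings of the family lie in (0, 1]. [folklore] -/
theorem ctFamily_g_mem (n k : ℕ) (hk : k ≤ (ctFamily K n).K) : 0 < (ctFamily K n).g k ∧ (ctFamily K n).g k ≤ 1 :=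
  ctRun_g_mem K n.cast_nonneg k hk

/-- The slot binding holds along the family. [folklore] -/
theorem ctFamily_specOK (n : ℕ) : SpecOK (ctFamily K n) :=
  (ctLeafSystem (z := (n : ℝ)) n.cast_nonneg K).spec

/-- **THEOREM 2 HOLDS ON THE FAMILY**, run by run from its leaf system (`B10Assembly.thm2_of_leafSystem`). [cite: Balaban1985UV3, Thm 2 p.272] -/
theorem thm2Printed_ctFamily : Thm2Printed (fun n : ℕ => (ctFamily K n).toRunData) :=
  fun n => thm2_of_leafSystem (fun _ : Unit => ctFamily K n) (fun _ => ctLeafSystem n.cast_nonneg K) ()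

variable {K} in
/-- **THEOREM 1 IN THE COMPACT READING FAILS ON THE FAMILY** (`K ≥ 1`): in the window `[g₀, 1]` (`g₀ = 2^{−K/2}` for every run) no single O(1) serves all runs at
the bare scale, since run `n` forces `O(1) ≥ n` (`le_of_bounds5At_ctRun_zero`) — the ε-uniformity of the (65) constants («we get easily |E^{(j)}| ≤ O(1)|T₁^{(j)}|»,
ONE O(1)) is an input of (5), not a consequence of Theorem 2. [cite: Balaban1985UV3, Thm 1 p.257, (65) p.273] -/
theorem not_thm1Compact_ctFamily (hK : 1 ≤ K) : ¬ Thm1PrintedCompact (fun n : ℕ => (ctFamily K n).toRunData) := by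
  intro h
  have hg0 : 0 < (ctRun 0 K).g 0 ∧ (ctRun 0 K).g 0 ≤ 1 := ctRun_g_mem K le_rfl 0 (Nat.zero_le _)
  obtain ⟨O1, hO1⟩ := h ((ctRun 0 K).g 0) 1 hg0.1 hg0.2
  obtain ⟨n, hn⟩ := exists_nat_gt O1
  have hg : (ctFamily K n).g 0 = (ctRun 0 K).g 0 := rfl
  have h5 : Bounds5At (ctFamily K n).toRunData O1 0 :=
    hO1 n 0 (Nat.zero_le _) (le_of_eq hg.symm) (by rw [hg]; exact hg0.2)
  have hle : (n : ℝ) ≤ O1 := le_of_bounds5At_ctRun_zero n.cast_nonneg hK h5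
  linarith

/-- **THE COUNTERTERM-SIDE SEPARATION, PACKAGED**: a family of tower runs EACH carrying a leaf system (per-run (65)-constant, `d(𝔤) = 0`, no large fields),
couplings in (0, 1], on which `B10.Thm2Printed` holds and `B10.Thm1PrintedCompact` fails.  A statement about the TYPING. [folklore] -/
theorem perRunCounterterm_separation :
    ∃ (I : Type) (T : I → TowerRun) (C : I → B10Assembly.Consts),
      (∀ i, Nonempty (LeafSystem (C i) (T i))) ∧ (∀ i k, k ≤ (T i).K → 0 < (T i).g k ∧ (T i).g k ≤ 1) ∧ (∀ i, (C i).dg = 0 ∧ (C i).d = 0)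
        ∧ Thm2Printed (fun i => (T i).toRunData) ∧ ¬ Thm1PrintedCompact (fun i => (T i).toRunData) :=
  ⟨ℕ, ctFamily 1, fun n => ctConsts n n.cast_nonneg, ctFamily_leafSystem 1, ctFamily_g_mem 1, fun _ => ⟨rfl, rfl⟩, thm2Printed_ctFamily 1,
    not_thm1Compact_ctFamily le_rfl⟩

/-- With ONE (65)-constant for the whole family (5) HOLDS (the cell's assembly theorem): the non-uniformity of `z` breaks Thm 1. [cite: Balaban1985UV3, Thm 1 p.257] -/
theorem thm1Compact_ctFamily_const {z : ℝ} (hz : 0 ≤ z) (K : ℕ) :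
    Thm1PrintedCompact (fun _ : ℕ => (ctRun z K).toRunData) ∧ Thm2Printed (fun _ : ℕ => (ctRun z K).toRunData) :=
  thm1Compact_and_thm2_of_leafSystem (fun _ : ℕ => ctRun z K) fun _ => ctLeafSystem hz K

end Family

/-! ## §3. The converse separation: (5) in the compact reading does NOT give the representation data (over the carrier) -/

section Converse
/-- **The functional-free model run of depth K**: `B10Assembly.trivRun K` (ρ_k ≡ χ_k ≡ 1) with the history functional of (41) set to ZERO, `LF_k(U, F) := 0`, and
the (41)∕(47) slot `False`: (5) holds with O(1) = 0 while (41)_k FAILS at every step, so NO leaf system exists on it ((41)₀ is `step0`). [folklore] -/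
def nolfRun (K : ℕ) : TowerRun where
  K := K
  Cfg := fun _ => Unit
  ρ := fun _ _ => 1
  χ := fun _ _ => 1
  wilsonBG := fun _ _ => 0
  sites := sitesRun 2 (lfEps K) 1
  g := gRun 1 2 (lfEps K)
  Ineq41_47 := fun _ => False
  Hist := fun _ => Unit
  triv := fun _ => ()
  LF := fun _ _ _ => 0
  lf_mono := fun _ _ _ _ _ => le_rfl
  lf_shift := fun _ _ _ t => by
    show (0 : ℝ) = Real.exp t * 0
    rw [mul_zero]
  mainT := fun _ _ _ => 0
  mainT_triv := fun _ _ => by simp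
  Pint := fun _ _ _ => 0
  Λvol := fun _ _ => 0
  Λvol_le := fun k _ => sitesRun_nonneg 2 _ 1 (by norm_num) (lfEps_pos K) zero_le_one k
  Zterm := fun _ _ => 0
  Zterm_triv := fun _ => rfl
  Ecst := fun _ => 0
  Estep := fun _ => 0
  Ecst_eq := fun _ => by simp
  Rm := fun _ => 0
  χ_nonneg := fun _ _ => zero_le_one
  sites_nonneg := fun k => sitesRun_nonneg 2 _ 1 (by norm_num) (lfEps_pos K) zero_le_one k
  M₁ := 0
  b₀ := 0
  p₀ := 1

variable (K : ℕ)

/-- **(41)_k FAILS on the functional-free model** at every step: `ρ_k = 1 ≤ LF_k(…) = 0` is false. [folklore] -/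
theorem not_ineq41_nolfRun (k : ℕ) : ¬ Ineq41 (nolfRun K) k := by
  intro h
  have h1 : (1 : ℝ) ≤ 0 := h ()
  linarith

/-- Hence NO leaf system exists on the functional-free model, for ANY constants (a leaf system carries (41)₀ ∧ (47)₀ in its field `step0`). [folklore] -/
theorem not_nonempty_leafSystem_nolfRun (C : B10Assembly.Consts) : ¬ Nonempty (LeafSystem C (nolfRun K)) :=
  fun ⟨S⟩ => not_ineq41_nolfRun K 0 S.step0.1

/-- The slot binding `SpecOK` holds on the functional-free model (slot `False`, (41)_k false). [folklore] -/
theorem nolfRun_specOK : SpecOK (nolfRun K) :=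
  fun k => ⟨fun h => h.elim, fun h => not_ineq41_nolfRun K k h.1⟩

/-- The couplings of the functional-free model lie in (0, 1] (same carrier scaling as `lfRun`). [folklore] -/
theorem nolfRun_g_mem (k : ℕ) (hk : k ≤ K) : 0 < (nolfRun K).g k ∧ (nolfRun K).g k ≤ 1 :=
  Summit.QuantumFields.YangMills.Theorems.BalabanUVNodesN08LargeFieldConstFamily.lfRun_g_mem (d := 0) K le_rfl k hk

/-- **(5) HOLDS on the functional-free model with O(1) = 0** at every step. [cite: Balaban1985UV3, (5) p.256] -/
theorem bounds5At_nolfRun (k : ℕ) : Bounds5At (nolfRun K).toRunData 0 k := by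
  intro U
  show (1 : ℝ) * Real.exp (-(((nolfRun K).g k)⁻¹ ^ 2 * 0) - 0 * (nolfRun K).sites k) ≤ 1 ∧ (1 : ℝ) ≤ Real.exp (0 * (nolfRun K).sites k)
  simp

/-- **Theorem 1 in the compact reading HOLDS on the functional-free family** (one constant O(1) = 0 serves every window). [cite: Balaban1985UV3, Thm 1 p.257] -/
theorem thm1Compact_nolfRun : Thm1PrintedCompact (fun _ : Unit => (nolfRun K).toRunData) :=
  fun _ _ _ _ => ⟨0, fun _ k _ _ _ => bounds5At_nolfRun K k⟩

/-- … while Theorem 2 (the slot, bound by `SpecOK` to (41) ∧ (47)) FAILS on it. [cite: Balaban1985UV3, Thm 2 p.272] -/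
theorem not_thm2Printed_nolfRun : ¬ Thm2Printed (fun _ : Unit => (nolfRun K).toRunData) :=
  fun h => h () 0 (Nat.zero_le _)

/-- **THE CONVERSE SEPARATION, PACKAGED**: tower runs with `SpecOK` and couplings in (0, 1] on which `B10.Thm1PrintedCompact` HOLDS, `B10.Thm2Printed` FAILS and
NO run carries a leaf system.  With `perRunCounterterm_separation` ∕ `perRunLeafSystems_separation`: over the carrier the two conjuncts of N08's slot — «(5), compact
reading» and «per-run representation data» — are INDEPENDENT (the split of `BalabanUVNodesN08RelativeTo5` is proper on both sides). [folklore] -/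
theorem thm1Compact_not_thm2_separation :
    ∃ (I : Type) (T : I → TowerRun), (∀ i, SpecOK (T i)) ∧ (∀ i k, k ≤ (T i).K → 0 < (T i).g k ∧ (T i).g k ≤ 1)
      ∧ Thm1PrintedCompact (fun i => (T i).toRunData) ∧ ¬ Thm2Printed (fun i => (T i).toRunData)
      ∧ ∀ i (C : B10Assembly.Consts), ¬ Nonempty (LeafSystem C (T i)) :=
  ⟨Unit, fun _ => nolfRun 0, fun _ => nolfRun_specOK 0, fun _ k hk => nolfRun_g_mem 0 k hk, thm1Compact_nolfRun 0, not_thm2Printed_nolfRun 0,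
    fun _ C => not_nonempty_leafSystem_nolfRun 0 C⟩

end Converse

end Summit.QuantumFields.YangMills.Theorems.BalabanUVNodesN08CountertermConstFamily

end
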